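import Literature.Analysis.ValidatedNumerics.TaylorModelExp
import Literature.Analysis.ValidatedNumerics.IntervalLogArctan
import Mathlib.Analysis.SpecialFunctions.Log.Deriv
import HarnessLib

/-!
# Taylor models of `log ∘ g` and `exp ∘ g` for a Taylor-modelled `g` (intrinsic functions by the addition theorem)

Trunk T-ANA (Analysis/ValidatedNumerics); namespace `Literature.Analysis.ValidatedNumerics.PolyMP`.
Sequel of `TaylorModel.lean` / `TaylorModelExp.lean`.  `TaylorModelExp.lean` encloses `e^{qρ}` in the IDENTITY
variable only and has no logarithm; `TaylorModelIntegralCert.lean` therefore certifies integrands built from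
rational polynomials and `e^{a+bt}`.  This file supplies the two INTRINSICS needed for general elementary
integrands, in the standard Makino–Berz / Joldeş `TMComp` form "split off the constant part, expand the rest":

* `log1pCoeffs K`, `abs_log_one_add_sub_le`: `|log(1+u) − Σ_{k=1}^{K} (−1)^{k+1}u^k/k| ≤ |u|^{K+1}/(1 − |u|)` for
  `|u| < 1` (Mathlib's `Real.abs_log_sub_add_sum_range_le`); `tlog1pI S h D K U` with `tmem_log1p`: the Taylor model
  of `ρ ↦ log(1 + u(ρ))` from a Taylor model `U` of `u` whose range bound certifies `|u|·S ≤ tabsI S h U < S`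
  (Horner on the coefficients in Taylor-model arithmetic, the remainder folded into the constant coefficient);
* `tlogTM S h D K Kl G` with `tmem_log_of_tlogTM`: the Taylor model of `log ∘ g` — `c` the rational midpoint of the
  constant coefficient of `G`, `log g = log c + log(1 + (g − c)/c)`, `log c` by `MI.logPos`; returned together with
  its acceptance flag, so that a certificate checker can conjoin it (`g > 0` on the panel FOLLOWS from acceptance);
* `expSerCoeffs K`, `abs_exp_sub_eval_le` (`Real.exp_bound`), `texpCompI S h D K U` with `tmem_expComp`
  (`|u|·S ≤ tabsI ≤ S`), and `texpTM S h D K Ke ke G` with `tmem_exp_of_texpTM`: `e^{g} = e^{c} · e^{g − c}`,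
  `e^{c}` by `MI.expPt`.

Problem-independent plumbing for kernel-checked integral certificates; no facts, no axioms.

## References

* M. Joldeş, *Rigorous Polynomial Approximations and Applications*, PhD thesis, ENS Lyon (2011): Section 2.2.1
  (Taylor models of basic functions: Taylor–Lagrange coefficients and remainder, thesis pp. 50–52) and
  Algorithm 2.2.8 `TMComp` (composition of a Taylor model with a basic function: split off the constant coefficient
  `a₀`, model the basic function around `a₀` over the bound of the argument, compose by polynomial evaluation of the
  shifted model, thesis p. 60). [cite: Joldes2011, Algorithm 2.2.8]
* K. Makino, M. Berz, *Taylor models and other validated functional inclusion methods*, Int. J. Pure Appl.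
  Math. 4 (2003) 379–456 (the origin of Taylor-model intrinsics by the addition theorems of `exp` and `log`).
  [cite: MakinoBerz2003, passim]
* The logarithmic series with remainder (Mathlib `Real.abs_log_sub_add_sum_range_le`) and the exponential series
  with remainder (Mathlib `Real.exp_bound`). [folklore]
-/

namespace Literature.Analysis.ValidatedNumerics

namespace PolyMP

open Literature.Analysis.ValidatedNumerics.NumericsMP
open Literature.Analysis.ValidatedNumerics.ExpPoly (Poly)

/-! ### `log (1 + u)` for a small Taylor-modelled `u` -/

/-- Taylor coefficients of `log(1+u)` up to degree `K`: `0, 1, −1/2, 1/3, …` (the `k = 0` entry is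
`(−1)^1/0 = 0` in `ℚ`). [folklore] -/
def log1pCoeffs (K : ℕ) : List ℚ := (List.range (K + 1)).map fun k : ℕ => (-1 : ℚ) ^ (k + 1) / (k : ℚ)

/-- **The logarithmic series with remainder**: for `|u| < 1`,
`|log(1+u) − Σ_{k ≤ K} c_k u^k| ≤ |u|^{K+1}/(1 − |u|)`. [folklore] -/
private theorem abs_log_one_add_sub_le {u : ℝ} (hu : |u| < 1) (K : ℕ) :
    |Real.log (1 + u) - Poly.eval (log1pCoeffs K) u| ≤ |u| ^ (K + 1) / (1 - |u|) := by
  have h := Real.abs_log_sub_add_sum_range_le (x := -u) (by rwa [abs_neg]) K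
  rw [abs_neg, sub_neg_eq_add] at h
  have hs : Poly.eval (log1pCoeffs K) u = -∑ i ∈ Finset.range K, (-u) ^ (i + 1) / (i + 1) := by
    rw [log1pCoeffs, poly_eval_map_range, Finset.sum_range_succ', ← Finset.sum_neg_distrib]
    simp only [Nat.cast_zero, pow_zero, mul_one]
    push_cast
    simp only [pow_one, div_zero, add_zero]
    refine Finset.sum_congr rfl fun k _ => ?_
    rw [neg_pow]
    ring
  rw [hs, sub_neg_eq_add, add_comm]
  exact h

/-- Scaled remainder bound `⌈S · (B/S)^{K+1}/(1 − B/S)⌉` from a scaled range bound `B` (`|u|·S ≤ B < S`).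
[folklore] -/
def tlog1pRem (S : ℕ) (B : ℤ) (K : ℕ) : ℤ :=
  ⌈(S : ℚ) * ((((B : ℚ) / S) ^ (K + 1)) / (1 - (B : ℚ) / S))⌉

/-- The Taylor model of `ρ ↦ log(1 + u(ρ))`: Horner on `log1pCoeffs K` in Taylor-model arithmetic (truncation
degree `D`) plus the remainder in the constant coefficient. [cite: Joldes2011, Section 2.2.1] -/
def tlog1pI (S : ℕ) (h : ℚ) (D K : ℕ) (U : IPoly) : IPoly :=
  widen0 (thornerI S h D (log1pCoeffs K) U) (tlog1pRem S (tabsI S h U) K)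

/-- **Soundness of `tlog1pI`.** If `U` encloses `u` on `|ρ| ≤ h` and its range bound certifies `|u| < 1`
(`tabsI S h U < S`), then `tlog1pI S h D K U` encloses `ρ ↦ log(1 + u(ρ))`. [cite: Joldes2011, Section 2.2.1] -/
theorem tmem_log1p {S : ℕ} (hS : 0 < S) {h : ℚ} (h0 : 0 ≤ h) (D K : ℕ) {u : ℝ → ℝ} {U : IPoly}
    (hu : TMem S h u U) (hB : tabsI S h U < S) :
    TMem S h (fun ρ => Real.log (1 + u ρ)) (tlog1pI S h D K U) := by
  intro ρ hρ
  obtain ⟨as, has, hev⟩ := tmem_horner hS h0 D hu (log1pCoeffs K) ρ hρ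
  have hSr : (0 : ℝ) < S := by exact_mod_cast hS
  have habs := abs_le_tabsI h0 hu hρ
  have hB1 : ((tabsI S h U : ℤ) : ℝ) / S < 1 := by
    rw [div_lt_one hSr]; exact_mod_cast hB
  have huB : |u ρ| ≤ ((tabsI S h U : ℤ) : ℝ) / S := by rw [le_div_iff₀ hSr]; exact habs
  have hu1 : |u ρ| < 1 := lt_of_le_of_lt huB hB1
  have hB0 : 0 ≤ ((tabsI S h U : ℤ) : ℝ) / S := (abs_nonneg _).trans huB
  have hδle : |Real.log (1 + u ρ) - Poly.eval (log1pCoeffs K) (u ρ)| * S ≤ (tlog1pRem S (tabsI S h U) K : ℝ) := by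
    have h1 := abs_log_one_add_sub_le hu1 K
    have hnum : |u ρ| ^ (K + 1) ≤ (((tabsI S h U : ℤ) : ℝ) / S) ^ (K + 1) := pow_le_pow_left₀ (abs_nonneg _) huB _
    have h2 : |u ρ| ^ (K + 1) / (1 - |u ρ|) ≤
        (((tabsI S h U : ℤ) : ℝ) / S) ^ (K + 1) / (1 - ((tabsI S h U : ℤ) : ℝ) / S) :=
      div_le_div₀ (pow_nonneg hB0 _) hnum (by linarith) (by linarith)
    have h3 := h1.trans h2
    have h4 : ((S : ℚ) * (((((tabsI S h U : ℤ) : ℚ) / S) ^ (K + 1)) / (1 - ((tabsI S h U : ℤ) : ℚ) / S)) : ℝ) ≤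
        (tlog1pRem S (tabsI S h U) K : ℝ) := by
      unfold tlog1pRem; exact_mod_cast Int.le_ceil _
    refine le_trans ?_ h4
    push_cast
    rw [mul_comm ((S : ℕ) : ℝ)]
    exact mul_le_mul_of_nonneg_right h3 hSr.le
  obtain ⟨bs, hbs, hev2⟩ := exists_widen0 has hδle ρ
  exact ⟨bs, hbs, by rw [hev2, ← hev]; ring⟩

/-! ### `log ∘ g` -/

/-- The rational midpoint of the constant coefficient of a Taylor model (`0` for the empty model). [folklore] -/
def mid0 (S : ℕ) : IPoly → ℚ
  | [] => 0
  | I :: _ => ((I.lo + I.hi : ℤ) : ℚ) / (2 * (S : ℚ))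

/-- The Taylor model of `log ∘ g` together with its acceptance flag: `c = mid0 S G`, `u = (g − c)/c`,
`log g = log c + log(1 + u)` with `log c ∈ MI.logPos S Kl (ofRat S c)` (refused if `c ≤ 0` cannot be excluded)
and `|u|·S ≤ tabsI < S`. [cite: Joldes2011, Algorithm 2.2.8] -/
def tlogTM (S : ℕ) (h : ℚ) (D K Kl : ℕ) (G : IPoly) : IPoly × Bool :=
  let c := mid0 S G
  let U := tsmulI S (ofRat S c⁻¹) (tsubI G (tconst (ofRat S c)))
  match MI.logPos S Kl (ofRat S c) with
  | none => ([], false)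
  | some L => (taddI (tconst L) (tlog1pI S h D K U), decide (tabsI S h U < S))

/-- **Soundness of `tlogTM`**: if `G` encloses `g` on `|ρ| ≤ h` and the flag is raised, then the returned model
encloses `ρ ↦ log(g(ρ))` (in particular `g > 0` on the panel). [cite: Joldes2011, Algorithm 2.2.8] -/
theorem tmem_log_of_tlogTM {S : ℕ} (hS : 0 < S) {h : ℚ} (h0 : 0 ≤ h) {D K Kl : ℕ} {g : ℝ → ℝ} {G : IPoly}
    (hg : TMem S h g G) (hok : (tlogTM S h D K Kl G).2 = true) :
    TMem S h (fun ρ => Real.log (g ρ)) (tlogTM S h D K Kl G).1 := by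
  unfold tlogTM at hok ⊢
  rcases hL : MI.logPos S Kl (ofRat S (mid0 S G)) with _ | L
  · simp only [hL] at hok; exact absurd hok Bool.false_ne_true
  · simp only [hL, decide_eq_true_eq] at hok ⊢
    obtain ⟨hc0, hlogc⟩ := MI.mem_logPos hS hL (mem_ofRat S (mid0 S G))
    have hU : TMem S h (fun ρ => (((mid0 S G)⁻¹ : ℚ) : ℝ) * (g ρ - ((mid0 S G : ℚ) : ℝ)))
        (tsmulI S (ofRat S (mid0 S G)⁻¹) (tsubI G (tconst (ofRat S (mid0 S G))))) :=
      tmem_smulI hS (mem_ofRat S _) (tmem_sub hg (tmem_const (mem_ofRat S _)))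
    have hsum := tmem_add (tmem_const (h := h) hlogc) (tmem_log1p hS h0 D K hU hok)
    intro ρ hρ
    obtain ⟨as, has, hev⟩ := hsum ρ hρ
    refine ⟨as, has, ?_⟩
    rw [← hev]
    have hSr : (0 : ℝ) < S := by exact_mod_cast hS
    have habs := abs_le_tabsI h0 hU hρ
    have hlt : (tabsI S h (tsmulI S (ofRat S (mid0 S G)⁻¹) (tsubI G (tconst (ofRat S (mid0 S G))))) : ℝ) < S := by
      exact_mod_cast hok
    have hu1 : |(((mid0 S G)⁻¹ : ℚ) : ℝ) * (g ρ - ((mid0 S G : ℚ) : ℝ))| < 1 := by nlinarith [abs_nonneg ((((mid0 S G)⁻¹ : ℚ) : ℝ) * (g ρ - ((mid0 S G : ℚ) : ℝ)))]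
    have hpos : 0 < 1 + (((mid0 S G)⁻¹ : ℚ) : ℝ) * (g ρ - ((mid0 S G : ℚ) : ℝ)) := by
      have := (abs_lt.1 hu1).1; linarith
    have hc0' : ((mid0 S G : ℚ) : ℝ) ≠ 0 := hc0.ne'
    have e : Real.log (g ρ) = Real.log ((mid0 S G : ℚ) : ℝ) +
        Real.log (1 + (((mid0 S G)⁻¹ : ℚ) : ℝ) * (g ρ - ((mid0 S G : ℚ) : ℝ))) := by
      rw [← Real.log_mul hc0' hpos.ne']
      congr 1
      push_cast
      field_simp
      ring
    exact e

/-! ### `exp ∘ g` -/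

/-- Taylor coefficients `1/k!`, `k < K`, of `e^{u}`. [folklore] -/
def expSerCoeffs (K : ℕ) : List ℚ := (List.range K).map fun k : ℕ => 1 / (k.factorial : ℚ)

/-- **The exponential series with remainder** (`Real.exp_bound`): for `|u| ≤ 1` and `0 < K`,
`|e^{u} − Σ_{k<K} u^k/k!| ≤ |u|^K (K+1)/(K!·K)`. [folklore] -/
private theorem abs_exp_sub_eval_le {u : ℝ} (hu : |u| ≤ 1) {K : ℕ} (hK : 0 < K) :
    |Real.exp u - Poly.eval (expSerCoeffs K) u| ≤ |u| ^ K * ((K + 1 : ℝ) / ((K.factorial : ℝ) * K)) := by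
  have h := Real.exp_bound hu hK
  have hs : Poly.eval (expSerCoeffs K) u = ∑ m ∈ Finset.range K, u ^ m / m.factorial := by
    rw [expSerCoeffs, poly_eval_map_range]
    refine Finset.sum_congr rfl fun k _ => ?_
    push_cast
    ring
  rw [hs]
  convert h using 2
  push_cast
  ring

/-- Scaled remainder bound `⌈S (B/S)^K (K+1)/(K!·K)⌉` from a scaled range bound `B` (`|u| S ≤ B ≤ S`). [folklore] -/
def texpCompRem (S : ℕ) (B : ℤ) (K : ℕ) : ℤ :=
  ⌈(S : ℚ) * (((B : ℚ) / S) ^ K * ((K + 1 : ℚ) / ((K.factorial : ℚ) * K)))⌉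

/-- The Taylor model of `ρ ↦ e^{u(ρ)}` for a small `u`: Horner on `expSerCoeffs K` plus the remainder.
[cite: Joldes2011, Section 2.2.1] -/
def texpCompI (S : ℕ) (h : ℚ) (D K : ℕ) (U : IPoly) : IPoly :=
  widen0 (thornerI S h D (expSerCoeffs K) U) (texpCompRem S (tabsI S h U) K)

/-- **Soundness of `texpCompI`** (`0 < K`, `tabsI S h U ≤ S`). [cite: Joldes2011, Section 2.2.1] -/
theorem tmem_expComp {S : ℕ} (hS : 0 < S) {h : ℚ} (h0 : 0 ≤ h) (D : ℕ) {K : ℕ} (hK : 0 < K) {u : ℝ → ℝ}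
    {U : IPoly} (hu : TMem S h u U) (hB : tabsI S h U ≤ S) :
    TMem S h (fun ρ => Real.exp (u ρ)) (texpCompI S h D K U) := by
  intro ρ hρ
  obtain ⟨as, has, hev⟩ := tmem_horner hS h0 D hu (expSerCoeffs K) ρ hρ
  have hSr : (0 : ℝ) < S := by exact_mod_cast hS
  have habs := abs_le_tabsI h0 hu hρ
  have huB : |u ρ| ≤ ((tabsI S h U : ℤ) : ℝ) / S := by rw [le_div_iff₀ hSr]; exact habs
  have hu1 : |u ρ| ≤ 1 := by
    have : ((tabsI S h U : ℤ) : ℝ) ≤ S := by exact_mod_cast hB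
    exact huB.trans ((div_le_one hSr).2 this)
  have hδle : |Real.exp (u ρ) - Poly.eval (expSerCoeffs K) (u ρ)| * S ≤ (texpCompRem S (tabsI S h U) K : ℝ) := by
    have h1 := abs_exp_sub_eval_le hu1 hK
    have h2 : |u ρ| ^ K ≤ (((tabsI S h U : ℤ) : ℝ) / S) ^ K := pow_le_pow_left₀ (abs_nonneg _) huB K
    have hc : (0 : ℝ) ≤ (K + 1 : ℝ) / ((K.factorial : ℝ) * K) := by positivity
    have h3 := h1.trans (mul_le_mul_of_nonneg_right h2 hc)
    have h4 : ((S : ℚ) * (((((tabsI S h U : ℤ) : ℚ) / S) ^ K) * ((K + 1 : ℚ) / ((K.factorial : ℚ) * K))) : ℝ) ≤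
        (texpCompRem S (tabsI S h U) K : ℝ) := by
      unfold texpCompRem; exact_mod_cast Int.le_ceil _
    refine le_trans ?_ h4
    push_cast
    rw [mul_comm ((S : ℕ) : ℝ)]
    exact mul_le_mul_of_nonneg_right h3 hSr.le
  obtain ⟨bs, hbs, hev2⟩ := exists_widen0 has hδle ρ
  exact ⟨bs, hbs, by rw [hev2, ← hev]; ring⟩

/-- The Taylor model of `exp ∘ g` together with its acceptance flag: `c = mid0 S G`, `e^{g} = e^{c} · e^{g − c}`,
`e^{c} ∈ MI.expPt S Ke ke (ofRat S c)`, `|g − c|·S ≤ tabsI ≤ S`, `0 < K`. [cite: Joldes2011, Algorithm 2.2.8] -/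
def texpTM (S : ℕ) (h : ℚ) (D K Ke ke : ℕ) (G : IPoly) : IPoly × Bool :=
  let c := mid0 S G
  let U := tsubI G (tconst (ofRat S c))
  match MI.expPt S Ke ke (ofRat S c) with
  | none => ([], false)
  | some E => (tsmulI S E (texpCompI S h D K U), decide (0 < K) && decide (tabsI S h U ≤ S))

/-- **Soundness of `texpTM`.** [cite: Joldes2011, Algorithm 2.2.8] -/
theorem tmem_exp_of_texpTM {S : ℕ} (hS : 0 < S) {h : ℚ} (h0 : 0 ≤ h) {D K Ke ke : ℕ} {g : ℝ → ℝ} {G : IPoly}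
    (hg : TMem S h g G) (hok : (texpTM S h D K Ke ke G).2 = true) :
    TMem S h (fun ρ => Real.exp (g ρ)) (texpTM S h D K Ke ke G).1 := by
  unfold texpTM at hok ⊢
  rcases hE : MI.expPt S Ke ke (ofRat S (mid0 S G)) with _ | E
  · simp only [hE] at hok; exact absurd hok Bool.false_ne_true
  · simp only [hE, Bool.and_eq_true, decide_eq_true_eq] at hok ⊢
    obtain ⟨hK, hB⟩ := hok
    have hexpc := MI.mem_expPt hS hE (mem_ofRat S (mid0 S G))
    have hU : TMem S h (fun ρ => g ρ - ((mid0 S G : ℚ) : ℝ)) (tsubI G (tconst (ofRat S (mid0 S G)))) :=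
      tmem_sub hg (tmem_const (mem_ofRat S _))
    have hprod := tmem_smulI hS hexpc (tmem_expComp hS h0 D hK hU hB)
    intro ρ hρ
    obtain ⟨as, has, hev⟩ := hprod ρ hρ
    refine ⟨as, has, ?_⟩
    rw [← hev]
    show Real.exp (g ρ) = Real.exp ((mid0 S G : ℚ) : ℝ) * Real.exp (g ρ - ((mid0 S G : ℚ) : ℝ))
    rw [← Real.exp_add]
    congr 1
    ring

end PolyMP

end Literature.Analysis.ValidatedNumerics
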